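import Mathlib
import HarnessLib
import Summits.NavierStokesRegularity.NavierStokesRegularity.Theorems.PoloidalWindowDoorPoloidalWindowRigidityConstantShearMeans

/-!
# Route `PoloidalWindowDoor`, item `LrcModEntire` (stmt-NavierStokesRegularity-20428) / crux K2 (stmt-19708), stratum (TH) —
# CASE II of the plane tower is ISOPARAMETRIC: if the vertical derivative `∂₂w` of the first integral `w = v₂` is constant along
# the vortex lines (a function of `(w, x₂)`), then so are `|∇ₕw|²` and `Δₕw`

Cell ns-regularity-ideate, seat nsreg-p7 gen 10 (structural worker; file landed `--supports stmt-NavierStokesRegularity-20428` as a helper).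
Kernel form of STRUCTURE-g10 §3a/§8 (HOME/ns-regularity-ideate-p7/g10/STRUCTURE-g10.md): in the (TH) stratum («shear slope a function of
height», `∂₂v_b = Λ(x₂) ∂_b w`, `b = 0,1`) the structural route's open input (ISO) — «on every horizontal plane the level curves of `w` are
isoparametric» — holds on the sub-stratum CASE II = «`∂₂w` is LEAFWISE», by pure kinematics plus ONE leafwise identity supplied by the dynamics:

* `fderiv_leaf_comp` — chain rule for a leafwise quantity `y ↦ g (w y, y₂)`.
* `leafwise_normSq_of_leafwise_vertical` — **STEP (3)**: (TH) proportional shear `∂₂v_b = Λ(y₂) ∂_b w` on an open set `U`, `∂₂w = σ(w, y₂)` on `U`,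
  and the leafwise pairing `v₀ ∂₀w + v₁ ∂₁w = ν(w, y₂)` on `U` (for (TH) germs this is the vertical momentum identity E of the plane tower, all of
  whose other terms are leafwise in Case II) ⇒ on `U`
  `Λ(y₂)·(∂₀w² + ∂₁w²) + ∂_ωσ(w,y₂)·ν(w,y₂) = Dν(w,y₂)(σ(w,y₂), 1)`: differentiate the pairing along `e₂`, use `∂₂v_b = Λ∂_b w`, the symmetry
  `∂₂∂_b w = ∂_b∂₂w = ∂_b[σ(w,y₂)] = ∂_ωσ·∂_b w`, and the chain rule on the right.  So `|∇ₕw|²` is a function of `(w, y₂)` wherever `Λ ≠ 0`.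
* `leafwise_laplacian_of_leafwise_vertical` — **STEP (1)**: the (TH) linear slice identity `∂₂²w = −Λ(y₂)(∂₀²w + ∂₁²w)` on `U` (tree:
  `…TimeHeightShearLinearSlice.plane_wave_identity` / `linearSlice_of_timeHeightShear`) and `∂₂w = σ(w,y₂)` on `U` ⇒
  `Λ(y₂)·Δₕw = −Dσ(w,y₂)(σ(w,y₂), 1)` on `U`.
* `isoparametric_leaves_of_leafwise_vertical` — packaging: under both, with `Λ ≠ 0` on the heights of `U`, there are functions `Q, L : ℝ × ℝ → ℝ`
  with `∂₀w² + ∂₁w² = Q(w, y₂)` and `∂₀²w + ∂₁²w = L(w, y₂)` on `U` — each plane's restriction of `w` is ISOPARAMETRIC, the input of the K2 lead's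
  planar Levi-Civita–Segre files (`Literature/Analysis/Calculus/PlaneIsoparametric*`) and of ns-poloidal-K2-p3's AXIS bricks.

So a (TH) germ is either CASE I (`{w, ∂₂w}ₕ ≢ 0`, where refuter1's constant-slope K-a lives) or has isoparametric leaves; STRUCTURE-g10 §3a shows
moreover that Case II with `|∇ₕw|²` NOT leafwise is empty for (TH), which is why no non-degeneracy of `|∇ₕw|²` is needed here.

WHAT THIS IS NOT: not a claim about Navier–Stokes regularity and not the stub — multivariable-calculus bookkeeping (bears_on LADDER-NS N0 via items
20428 / 19708).
-/

noncomputable section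

-- the summit and its single sub-problem share the name (CONVENTIONS §1), as in every Theorems file
set_option linter.dupNamespace false

namespace Summit.NavierStokesRegularity.NavierStokesRegularity.Theorems.PoloidalWindowDoorLrcModEntireLeafwiseVertical

open Set Function Filter Topology
open Summit.NavierStokesRegularity.NavierStokesRegularity.Theorems.PoloidalWindowDoorPoloidalWindowRigidityConstantShearMeans

/-! ### Chain rule for leafwise quantities -/

/-- The leaf map `y ↦ (w y, y₂)` has derivative `h ↦ (Dw(y) h, h₂)`. [folklore] -/
theorem hasFDerivAt_leafMap {w : EuclideanSpace ℝ (Fin 3) → ℝ} {y : EuclideanSpace ℝ (Fin 3)} (hw : DifferentiableAt ℝ w y) :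
    HasFDerivAt (fun y : EuclideanSpace ℝ (Fin 3) => (w y, y 2)) ((fderiv ℝ w y).prod (EuclideanSpace.proj (𝕜 := ℝ) (2 : Fin 3))) y :=
  hw.hasFDerivAt.prodMk (EuclideanSpace.proj (𝕜 := ℝ) (2 : Fin 3)).hasFDerivAt

/-- **Chain rule for a leafwise quantity**: `D[g(w, y₂)](y) h = Dg(w y, y₂)(Dw(y) h, h₂)`. [folklore] -/
theorem fderiv_leaf_comp {g : ℝ × ℝ → ℝ} {w : EuclideanSpace ℝ (Fin 3) → ℝ} {y : EuclideanSpace ℝ (Fin 3)} (hg : DifferentiableAt ℝ g (w y, y 2))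
    (hw : DifferentiableAt ℝ w y) (h : EuclideanSpace ℝ (Fin 3)) :
    fderiv ℝ (fun y : EuclideanSpace ℝ (Fin 3) => g (w y, y 2)) y h = fderiv ℝ g (w y, y 2) (fderiv ℝ w y h, h 2) := by
  have hc := hg.hasFDerivAt.comp y (hasFDerivAt_leafMap hw)
  rw [show (fun y : EuclideanSpace ℝ (Fin 3) => g (w y, y 2)) = g ∘ fun y : EuclideanSpace ℝ (Fin 3) => (w y, y 2) from rfl, hc.fderiv]
  rfl

/-- Differentiability of a leafwise quantity. [folklore] -/
theorem differentiableAt_leaf_comp {g : ℝ × ℝ → ℝ} {w : EuclideanSpace ℝ (Fin 3) → ℝ} {y : EuclideanSpace ℝ (Fin 3)} (hg : DifferentiableAt ℝ g (w y, y 2))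
    (hw : DifferentiableAt ℝ w y) : DifferentiableAt ℝ (fun y : EuclideanSpace ℝ (Fin 3) => g (w y, y 2)) y :=
  (hg.hasFDerivAt.comp y (hasFDerivAt_leafMap hw)).differentiableAt

/-- Along a HORIZONTAL direction the leaf chain rule has no `∂₂`-term: `D[g(w,y₂)](y) e_b = ∂_b w(y) · Dg(w y, y₂)(1, 0)` for `b ≠ 2`. [folklore] -/
theorem fderiv_leaf_comp_horizontal {g : ℝ × ℝ → ℝ} {w : EuclideanSpace ℝ (Fin 3) → ℝ} {y : EuclideanSpace ℝ (Fin 3)} (hg : DifferentiableAt ℝ g (w y, y 2))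
    (hw : DifferentiableAt ℝ w y) {b : Fin 3} (hb : b ≠ 2) :
    fderiv ℝ (fun y : EuclideanSpace ℝ (Fin 3) => g (w y, y 2)) y (EuclideanSpace.single b (1 : ℝ)) = fderiv ℝ w y (EuclideanSpace.single b (1 : ℝ)) * fderiv ℝ g (w y, y 2) (1, 0) := by
  rw [fderiv_leaf_comp hg hw]
  have h2 : (EuclideanSpace.single b (1 : ℝ) : EuclideanSpace ℝ (Fin 3)) 2 = 0 := by simp [hb.symm]
  rw [h2, show ((fderiv ℝ w y (EuclideanSpace.single b (1 : ℝ)), (0 : ℝ)) : ℝ × ℝ) = fderiv ℝ w y (EuclideanSpace.single b (1 : ℝ)) • ((1 : ℝ), (0 : ℝ)) by simp,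
    map_smul, smul_eq_mul]

/-- Along the VERTICAL direction: `D[g(w,y₂)](y) e₂ = Dg(w y, y₂)(∂₂w(y), 1)`. [folklore] -/
theorem fderiv_leaf_comp_vertical {g : ℝ × ℝ → ℝ} {w : EuclideanSpace ℝ (Fin 3) → ℝ} {y : EuclideanSpace ℝ (Fin 3)} (hg : DifferentiableAt ℝ g (w y, y 2))
    (hw : DifferentiableAt ℝ w y) :
    fderiv ℝ (fun y : EuclideanSpace ℝ (Fin 3) => g (w y, y 2)) y (EuclideanSpace.single 2 (1 : ℝ)) = fderiv ℝ g (w y, y 2) (fderiv ℝ w y (EuclideanSpace.single 2 (1 : ℝ)), 1) := by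
  rw [fderiv_leaf_comp hg hw]
  simp

/-! ### Step (3): the squared horizontal gradient is leafwise -/

/-- **STEP (3) of STRUCTURE-g10 §3a ((TH), Case II).**  Let `w : ℝ³ → ℝ` be `C²`, `v₀, v₁ : ℝ³ → ℝ` differentiable, `U` open, and suppose on `U`:
(TH) `∂₂v_b = Λ(y₂) ∂_b w` (`b = 0,1`); CASE II `∂₂w = σ(w, y₂)`; and the leafwise pairing `v₀∂₀w + v₁∂₁w = ν(w, y₂)` (`σ, ν : ℝ × ℝ → ℝ`
differentiable).  Then on `U`
`Λ(y₂)(∂₀w² + ∂₁w²) + ∂_ωσ(w,y₂)·ν(w,y₂) = Dν(w,y₂)(σ(w,y₂), 1)` — so `|∇ₕw|²` is a function of `(w, y₂)` wherever `Λ ≠ 0`. [folklore] -/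
theorem leafwise_normSq_of_leafwise_vertical {w v₀ v₁ : EuclideanSpace ℝ (Fin 3) → ℝ} {Λ : ℝ → ℝ} {σ ν : ℝ × ℝ → ℝ} {U : Set (EuclideanSpace ℝ (Fin 3))}
    (hU : IsOpen U) (hw : ContDiff ℝ 2 w) (hv₀ : Differentiable ℝ v₀) (hv₁ : Differentiable ℝ v₁)
    (hσ : Differentiable ℝ σ) (hν : Differentiable ℝ ν)
    (hTH : ∀ y ∈ U, fderiv ℝ v₀ y (EuclideanSpace.single 2 (1 : ℝ)) = Λ (y 2) * fderiv ℝ w y (EuclideanSpace.single 0 (1 : ℝ)) ∧ fderiv ℝ v₁ y (EuclideanSpace.single 2 (1 : ℝ)) = Λ (y 2) * fderiv ℝ w y (EuclideanSpace.single 1 (1 : ℝ)))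
    (hII : ∀ y ∈ U, fderiv ℝ w y (EuclideanSpace.single 2 (1 : ℝ)) = σ (w y, y 2))
    (hpair : ∀ y ∈ U, v₀ y * fderiv ℝ w y (EuclideanSpace.single 0 (1 : ℝ)) + v₁ y * fderiv ℝ w y (EuclideanSpace.single 1 (1 : ℝ)) = ν (w y, y 2)) :
    ∀ y ∈ U, Λ (y 2) * (fderiv ℝ w y (EuclideanSpace.single 0 (1 : ℝ)) ^ 2 + fderiv ℝ w y (EuclideanSpace.single 1 (1 : ℝ)) ^ 2) +
        fderiv ℝ σ (w y, y 2) (1, 0) * ν (w y, y 2) = fderiv ℝ ν (w y, y 2) (σ (w y, y 2), 1) := by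
  intro y hy
  have hwd : Differentiable ℝ w := hw.differentiable (by norm_num)
  -- the partial derivatives `y ↦ ∂_a w(y)` are `C¹`, hence differentiable
  have hd1 : ∀ (a : EuclideanSpace ℝ (Fin 3)) (x : EuclideanSpace ℝ (Fin 3)), DifferentiableAt ℝ (fun y' => fderiv ℝ w y' a) x := fun a x =>
    (((hw.fderiv_right (m := 1) (by norm_num)).clm_apply contDiff_const).differentiable one_ne_zero) x
  have hUy : U ∈ 𝓝 y := hU.mem_nhds hy
  -- (i) differentiate the pairing identity along `e₂`
  set T : EuclideanSpace ℝ (Fin 3) → ℝ := fun y' => v₀ y' * fderiv ℝ w y' (EuclideanSpace.single 0 (1 : ℝ)) + v₁ y' * fderiv ℝ w y' (EuclideanSpace.single 1 (1 : ℝ)) with hT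
  have hTN : T =ᶠ[𝓝 y] fun y' => ν (w y', y' 2) := by
    filter_upwards [hUy] with y' hy' using hpair y' hy'
  have hDT : fderiv ℝ T y (EuclideanSpace.single 2 (1 : ℝ)) = fderiv ℝ ν (w y, y 2) (σ (w y, y 2), 1) := by
    rw [hTN.fderiv_eq, fderiv_leaf_comp_vertical (hν _) (hwd y), hII y hy]
  -- (ii) compute `∂₂T` by Leibniz
  have hT0 : DifferentiableAt ℝ (fun y' => v₀ y' * fderiv ℝ w y' (EuclideanSpace.single 0 (1 : ℝ))) y := (hv₀ y).mul (hd1 _ y)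
  have hT1 : DifferentiableAt ℝ (fun y' => v₁ y' * fderiv ℝ w y' (EuclideanSpace.single 1 (1 : ℝ))) y := (hv₁ y).mul (hd1 _ y)
  have hDT' : fderiv ℝ T y (EuclideanSpace.single 2 (1 : ℝ)) =
      (v₀ y * fderiv ℝ (fun y' => fderiv ℝ w y' (EuclideanSpace.single 0 (1 : ℝ))) y (EuclideanSpace.single 2 (1 : ℝ)) + fderiv ℝ w y (EuclideanSpace.single 0 (1 : ℝ)) * fderiv ℝ v₀ y (EuclideanSpace.single 2 (1 : ℝ))) +
        (v₁ y * fderiv ℝ (fun y' => fderiv ℝ w y' (EuclideanSpace.single 1 (1 : ℝ))) y (EuclideanSpace.single 2 (1 : ℝ)) + fderiv ℝ w y (EuclideanSpace.single 1 (1 : ℝ)) * fderiv ℝ v₁ y (EuclideanSpace.single 2 (1 : ℝ))) := by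
    rw [hT, fderiv_fun_add hT0 hT1]
    simp only [_root_.add_apply]
    rw [fderiv_mul_apply (hv₀ y) (hd1 _ y), fderiv_mul_apply (hv₁ y) (hd1 _ y)]
  -- (iii) the mixed partials: `∂₂∂_b w = ∂_b ∂₂w = ∂_b[σ(w,y₂)] = ∂_b w · ∂_ωσ`
  have hS : (fun y' => fderiv ℝ w y' (EuclideanSpace.single 2 (1 : ℝ))) =ᶠ[𝓝 y] fun y' => σ (w y', y' 2) := by
    filter_upwards [hUy] with y' hy' using hII y' hy'
  have hmix : ∀ b : Fin 3, b ≠ 2 →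
      fderiv ℝ (fun y' => fderiv ℝ w y' (EuclideanSpace.single b (1 : ℝ))) y (EuclideanSpace.single 2 (1 : ℝ)) = fderiv ℝ w y (EuclideanSpace.single b (1 : ℝ)) * fderiv ℝ σ (w y, y 2) (1, 0) := by
    intro b hb
    rw [fderiv_fderiv_symm hw y (EuclideanSpace.single b (1 : ℝ)) (EuclideanSpace.single 2 (1 : ℝ)), hS.fderiv_eq, fderiv_leaf_comp_horizontal (hσ _) (hwd y) hb]
  rw [hDT', hmix 0 (by decide), hmix 1 (by decide), (hTH y hy).1, (hTH y hy).2] at hDT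
  rw [← hDT, ← hpair y hy]
  ring

/-! ### Step (1): the horizontal Laplacian is leafwise -/

/-- **STEP (1) of STRUCTURE-g10 §3a ((TH), Case II).**  Let `w : ℝ³ → ℝ` be `C²`, `U` open, with the (TH) linear slice identity
`∂₂(∂₂w) = −Λ(y₂)(∂₀(∂₀w) + ∂₁(∂₁w))` on `U` (tree `…TimeHeightShearLinearSlice`) and CASE II `∂₂w = σ(w,y₂)` on `U` (`σ` differentiable).
Then `Λ(y₂)·(∂₀²w + ∂₁²w) = −Dσ(w,y₂)(σ(w,y₂), 1)` on `U`: `Δₕw` is a function of `(w, y₂)` wherever `Λ ≠ 0`. [folklore] -/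
theorem leafwise_laplacian_of_leafwise_vertical {w : EuclideanSpace ℝ (Fin 3) → ℝ} {Λ : ℝ → ℝ} {σ : ℝ × ℝ → ℝ} {U : Set (EuclideanSpace ℝ (Fin 3))}
    (hU : IsOpen U) (hw : ContDiff ℝ 2 w) (hσ : Differentiable ℝ σ)
    (hlin : ∀ y ∈ U, fderiv ℝ (fun y' => fderiv ℝ w y' (EuclideanSpace.single 2 (1 : ℝ))) y (EuclideanSpace.single 2 (1 : ℝ)) =
      -Λ (y 2) * (fderiv ℝ (fun y' => fderiv ℝ w y' (EuclideanSpace.single 0 (1 : ℝ))) y (EuclideanSpace.single 0 (1 : ℝ)) + fderiv ℝ (fun y' => fderiv ℝ w y' (EuclideanSpace.single 1 (1 : ℝ))) y (EuclideanSpace.single 1 (1 : ℝ))))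
    (hII : ∀ y ∈ U, fderiv ℝ w y (EuclideanSpace.single 2 (1 : ℝ)) = σ (w y, y 2)) :
    ∀ y ∈ U, Λ (y 2) * (fderiv ℝ (fun y' => fderiv ℝ w y' (EuclideanSpace.single 0 (1 : ℝ))) y (EuclideanSpace.single 0 (1 : ℝ)) + fderiv ℝ (fun y' => fderiv ℝ w y' (EuclideanSpace.single 1 (1 : ℝ))) y (EuclideanSpace.single 1 (1 : ℝ))) =
      -fderiv ℝ σ (w y, y 2) (σ (w y, y 2), 1) := by
  intro y hy
  have hwd : Differentiable ℝ w := hw.differentiable (by norm_num)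
  have hS : (fun y' => fderiv ℝ w y' (EuclideanSpace.single 2 (1 : ℝ))) =ᶠ[𝓝 y] fun y' => σ (w y', y' 2) := by
    filter_upwards [hU.mem_nhds hy] with y' hy' using hII y' hy'
  have h := hlin y hy
  rw [hS.fderiv_eq, fderiv_leaf_comp_vertical (hσ _) (hwd y), hII y hy] at h
  linarith

/-! ### Packaging: isoparametric leaves -/

/-- **(TH) ∩ CASE II ⇒ ISOPARAMETRIC LEAVES.**  Under the hypotheses of the two steps and `Λ(y₂) ≠ 0` for `y ∈ U`, there are functions
`Q, L : ℝ × ℝ → ℝ` with `∂₀w(y)² + ∂₁w(y)² = Q(w y, y₂)` and `∂₀²w(y) + ∂₁²w(y) = L(w y, y₂)` for all `y ∈ U`: on every horizontal plane the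
restriction of `w` to `U` is an isoparametric function (both `|∇ₕw|²` and `Δₕw` constant along its level curves), the input of the planar
Levi-Civita–Segre dichotomy (circles or lines). [folklore] -/
theorem isoparametric_leaves_of_leafwise_vertical {w v₀ v₁ : EuclideanSpace ℝ (Fin 3) → ℝ} {Λ : ℝ → ℝ} {σ ν : ℝ × ℝ → ℝ} {U : Set (EuclideanSpace ℝ (Fin 3))}
    (hU : IsOpen U) (hw : ContDiff ℝ 2 w) (hv₀ : Differentiable ℝ v₀) (hv₁ : Differentiable ℝ v₁)
    (hσ : Differentiable ℝ σ) (hν : Differentiable ℝ ν) (hΛ : ∀ y ∈ U, Λ (y 2) ≠ 0)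
    (hTH : ∀ y ∈ U, fderiv ℝ v₀ y (EuclideanSpace.single 2 (1 : ℝ)) = Λ (y 2) * fderiv ℝ w y (EuclideanSpace.single 0 (1 : ℝ)) ∧ fderiv ℝ v₁ y (EuclideanSpace.single 2 (1 : ℝ)) = Λ (y 2) * fderiv ℝ w y (EuclideanSpace.single 1 (1 : ℝ)))
    (hlin : ∀ y ∈ U, fderiv ℝ (fun y' => fderiv ℝ w y' (EuclideanSpace.single 2 (1 : ℝ))) y (EuclideanSpace.single 2 (1 : ℝ)) =
      -Λ (y 2) * (fderiv ℝ (fun y' => fderiv ℝ w y' (EuclideanSpace.single 0 (1 : ℝ))) y (EuclideanSpace.single 0 (1 : ℝ)) + fderiv ℝ (fun y' => fderiv ℝ w y' (EuclideanSpace.single 1 (1 : ℝ))) y (EuclideanSpace.single 1 (1 : ℝ))))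
    (hII : ∀ y ∈ U, fderiv ℝ w y (EuclideanSpace.single 2 (1 : ℝ)) = σ (w y, y 2))
    (hpair : ∀ y ∈ U, v₀ y * fderiv ℝ w y (EuclideanSpace.single 0 (1 : ℝ)) + v₁ y * fderiv ℝ w y (EuclideanSpace.single 1 (1 : ℝ)) = ν (w y, y 2)) :
    ∃ Q L : ℝ × ℝ → ℝ, ∀ y ∈ U,
      fderiv ℝ w y (EuclideanSpace.single 0 (1 : ℝ)) ^ 2 + fderiv ℝ w y (EuclideanSpace.single 1 (1 : ℝ)) ^ 2 = Q (w y, y 2) ∧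
      fderiv ℝ (fun y' => fderiv ℝ w y' (EuclideanSpace.single 0 (1 : ℝ))) y (EuclideanSpace.single 0 (1 : ℝ)) + fderiv ℝ (fun y' => fderiv ℝ w y' (EuclideanSpace.single 1 (1 : ℝ))) y (EuclideanSpace.single 1 (1 : ℝ)) = L (w y, y 2) := by
  refine ⟨fun p => (fderiv ℝ ν p (σ p, 1) - fderiv ℝ σ p (1, 0) * ν p) / Λ p.2,
    fun p => -fderiv ℝ σ p (σ p, 1) / Λ p.2, fun y hy => ⟨?_, ?_⟩⟩
  · have h := leafwise_normSq_of_leafwise_vertical hU hw hv₀ hv₁ hσ hν hTH hII hpair y hy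
    field_simp [hΛ y hy]
    linarith
  · have h := leafwise_laplacian_of_leafwise_vertical hU hw hσ hlin hII y hy
    field_simp [hΛ y hy]
    linarith

end Summit.NavierStokesRegularity.NavierStokesRegularity.Theorems.PoloidalWindowDoorLrcModEntireLeafwiseVertical
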